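import Literature.NumberTheory.EllipticCurves.BSDHeegnerPoints
import Literature.NumberTheory.EllipticCurves.ModularCurveManinConstantProofs
import Literature.NumberTheory.EllipticCurves.HeightsProofs
import HarnessLib

/-!
# bsd.S16 corollaries threaded through the Gross–Zagier named fact

Sibling proof file of `Literature/NumberTheory/EllipticCurves/BSDHeegnerPoints.lean` (family
`bsd`, item S16) and `…/HeegnerPoints.lean` (trunk EllArithM, item C18).  With the Manin constant
non-zero unconditionally (`ModularParametrizationData.maninConstant_ne_zero_holds`,
`ModularCurveManinConstantProofs.lean`) and `ĥ P = 0 ↔ P` torsion discharged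
(`canonicalHeight_eq_zero_iff_holds`, `HeightsProofs.lean`, Silverman AEC VIII.9.3(d)), the
Gross–Zagier constant `‖ω‖²/(c² u² √|d_K|)` is positive for *every* parametrisation datum and the
"in particular" of Gross 1991, (1.1) becomes an equivalence relative to the single named fact
`Literature.NumberTheory.EllipticCurves.gross_zagier` (Gross–Zagier 1986, Thm. I.(6.3)/(6.5); Cai–Shu–Tian 2014, Thm. 1.1):

* `grossZagierConstant_pos'` : `0 < grossZagierConstant Dt K`, unconditionally.
* `lDerivEK_ne_zero_iff_not_isOfFinAddOrder` : under `gross_zagier N W K`, for a Heegner point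
  `P ∈ E(K)` of level `N`: `L'(E/K, 1) ≠ 0 ↔ P` has infinite order (Gross 1991, (1.1): "in
  particular, the point `y_K` has infinite order if and only if `L'(E/K, 1) ≠ 0`").  The forward
  direction alone, which needs neither `c ≠ 0` nor VIII.9.3(d) in full, is
  `WeierstrassCurve.not_isOfFinAddOrder_of_isHeegnerPoint_of_LDerivEK_ne_zero`
  (`LeadingTermHeegnerProofs.lean`, not imported here).
* `analyticRankEK_eq_one_iff_heegner_nonTorsion_of` : the named fact
  `Literature.NumberTheory.EllipticCurves.analyticRankEK_eq_one_iff_heegner_nonTorsion` (bsd.S16, corollary: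
  `ord_{s=1} L(E/K, s) = 1 ↔ P_K` non-torsion) follows from `gross_zagier` and the analytic lemma
  `analyticRankEK_eq_one_iff_LDerivEK_ne_zero` (`ord = 1 ↔ L' ≠ 0`, given `ord ≥ 1`).
* `isOfFinAddOrder_iff_of_isHeegnerPoint_of` : under the hypotheses of `gross_zagier`, any two
  Heegner points of level `N` in `E(K)` are simultaneously torsion or non-torsion — the case of the
  named fact `Literature.NumberTheory.EllipticCurves.isOfFinAddOrder_iff_of_isHeegnerPoint` in which `K` is imaginary quadratic
  with the Heegner hypothesis.
* `analyticOrderNatAt_eq_one_iff_deriv_ne_zero` : for a germ of genuine order `≥ 1` at `z₀`,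
  the order is `1` iff the first derivative at `z₀` is non-zero (Taylor expansion; Mathlib
  `analyticOrderAt_eq_nat_iff_iteratedDeriv_eq_zero`).
* `analyticRankEK_eq_one_iff_LDerivEK_ne_zero_of` : hence the named fact
  `Literature.NumberTheory.EllipticCurves.analyticRankEK_eq_one_iff_LDerivEK_ne_zero` (`ord_{s=1} L(E/K, s) = 1 ↔ L'(E/K, 1) ≠ 0`)
  follows from the single named fact `Literature.NumberTheory.EllipticCurves.one_le_analyticRankEK` (`L(E/K, 1) = 0`: sign `−1`
  of the functional equation under the Heegner hypothesis, Gross 1984, §5) — the forward direction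
  being unconditional (cf. `LDerivEK_ne_zero_of_analyticRankEK_eq_one`, `LeadingTermProofs.lean`).
* `analyticRankEK_eq_one_iff_heegner_nonTorsion_of_one_le` : so bsd.S16's corollary
  `ord_{s=1} L(E/K, s) = 1 ↔ P_K` non-torsion needs exactly `gross_zagier` and
  `one_le_analyticRankEK`.

Nothing new is asserted: every theorem takes the remaining primary named facts as hypotheses.

## References

* B. H. Gross, D. B. Zagier, *Heegner points and derivatives of `L`-series*, Invent. Math. 84
  (1986), 225–320, Thm. I.(6.3), I.(6.5), V.§2. [GrossZagier1986]
* B. H. Gross, *Kolyvagin's work on modular elliptic curves*, in *`L`-functions and arithmetic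
  (Durham, 1989)*, LMS Lecture Notes 153 (1991), 235–256, (1.1). [Gross1991]
* L. Cai, J. Shu, Y. Tian, *Explicit Gross–Zagier and Waldspurger formulae*, Algebra Number
  Theory 8 (2014), 2523–2572, Thm. 1.1. [CaiShuTian2014]
* J. H. Silverman, *The Arithmetic of Elliptic Curves*, 2nd ed., Thm. VIII.9.3(d). [SilvermanAEC2009]
-/

noncomputable section

open scoped Classical

open NumberField Literature.NumberTheory.EllipticCurves.ModularForms

universe u

namespace Literature.NumberTheory.EllipticCurves

variable (W : WeierstrassCurve ℚ) (N : ℕ) [NeZero N] (K : Type u) [Field K] [NumberField K]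

/-- The Gross–Zagier constant `‖ω‖² / (c² u² √|d_K|)` of any parametrisation datum is positive,
unconditionally (`grossZagierConstant_pos` fed with `maninConstant_ne_zero_holds`).
[cite: GrossZagier1986, Thm. I.(6.3)] -/
theorem grossZagierConstant_pos' (Dt : ModularParametrizationData W N) :
    0 < grossZagierConstant Dt K :=
  grossZagierConstant_pos W N K Dt Dt.maninConstant_ne_zero_holds

/-- **Gross 1991, (1.1), "in particular".** Assume the Gross–Zagier theorem `gross_zagier N W K`.
For an elliptic `W/ℚ`, an imaginary quadratic `K` satisfying the Heegner hypothesis for `N` and a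
Heegner point `P ∈ E(K)` of level `N`: `L'(E/K, 1) ≠ 0 ↔ P` has infinite order, since
`L'(E/K, 1) = (positive constant) · ĥ(P)` (`grossZagierConstant_pos'`) and `ĥ(P) = 0 ↔ P` is
torsion (`canonicalHeight_eq_zero_iff_holds`, Silverman AEC VIII.9.3(d)). [cite: Gross1991, (1.1)] -/
theorem lDerivEK_ne_zero_iff_not_isOfFinAddOrder [W.IsElliptic] (hGZ : gross_zagier N W K)
    (hK : IsImaginaryQuadratic K) (hH : SatisfiesHeegnerHypothesis N K)
    {P : (W.baseChange K).toAffine.Point} (hP : IsHeegnerPoint N W K P) :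
    LDerivEK W K ≠ 0 ↔ ¬ IsOfFinAddOrder P := by
  obtain ⟨Dt, Hd, ι, hPt⟩ := hP
  have hL : LDerivEK W K = ((grossZagierConstant Dt K * P.canonicalHeight : ℝ) : ℂ) :=
    (grossZagierFormula_iff W N K).mp (hGZ hK hH) Dt Hd ι P hPt
  haveI : (W.baseChange K).IsElliptic := by rw [WeierstrassCurve.baseChange]; infer_instance
  rw [hL, ne_eq, Complex.ofReal_eq_zero, mul_eq_zero,
    or_iff_right (grossZagierConstant_pos' W N K Dt).ne',
    WeierstrassCurve.Affine.Point.canonicalHeight_eq_zero_iff_holds P]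

/-- **bsd.S16, corollary, threaded.** The named fact
`analyticRankEK_eq_one_iff_heegner_nonTorsion W N K` (`ord_{s=1} L(E/K, s) = 1 ↔ P_K` non-torsion,
for an elliptic curve with globally minimal model `W` of conductor `N` and an imaginary quadratic
`K` satisfying the Heegner hypothesis) follows from the Gross–Zagier theorem (`gross_zagier`) and
the analytic lemma `analyticRankEK_eq_one_iff_LDerivEK_ne_zero` (`ord = 1 ↔ L' ≠ 0` given
`ord ≥ 1`), via `lDerivEK_ne_zero_iff_not_isOfFinAddOrder` (Gross–Zagier 1986, Thm. I.(6.3) with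
V.§2; Gross 1991, (1.1)). [cite: GrossZagier1986, Thm. I.(6.3) with V.§2] -/
theorem analyticRankEK_eq_one_iff_heegner_nonTorsion_of (hGZ : gross_zagier N W K)
    (h₁ : analyticRankEK_eq_one_iff_LDerivEK_ne_zero W N K) :
    analyticRankEK_eq_one_iff_heegner_nonTorsion W N K := by
  intro _ _ hK hN hH P hP
  rw [h₁ hK hN hH]
  exact lDerivEK_ne_zero_iff_not_isOfFinAddOrder W N K hGZ hK hH hP

/-- Under the hypotheses of the Gross–Zagier theorem (elliptic `W/ℚ`, imaginary quadratic `K`,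
Heegner hypothesis for `N`), any two Heegner points of level `N` in `E(K)` are simultaneously of
finite or of infinite order: each is non-torsion iff `L'(E/K, 1) ≠ 0`
(`lDerivEK_ne_zero_iff_not_isOfFinAddOrder`). This is the case of the named fact
`isOfFinAddOrder_iff_of_isHeegnerPoint W N K` that concerns genuine Heegner points
(Gross–Zagier 1986, I.(6.1) and V.§2; Gross 1991, (1.1)). [cite: Gross1991, (1.1)] -/
theorem isOfFinAddOrder_iff_of_isHeegnerPoint_of [W.IsElliptic] (hGZ : gross_zagier N W K)
    (hK : IsImaginaryQuadratic K) (hH : SatisfiesHeegnerHypothesis N K)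
    {P P' : (W.baseChange K).toAffine.Point} (hP : IsHeegnerPoint N W K P)
    (hP' : IsHeegnerPoint N W K P') : IsOfFinAddOrder P ↔ IsOfFinAddOrder P' := by
  rw [← not_iff_not, ← lDerivEK_ne_zero_iff_not_isOfFinAddOrder W N K hGZ hK hH hP,
    ← lDerivEK_ne_zero_iff_not_isOfFinAddOrder W N K hGZ hK hH hP']

/-! ### `ord_{s=1} L(E/K, s) = 1 ↔ L'(E/K, 1) ≠ 0` from `L(E/K, 1) = 0` -/

/-- **A genuine zero is simple iff the first derivative is non-zero.** If the germ of `f` at `z₀`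
has genuine order `≥ 1` (Mathlib `analyticOrderNatAt`, whose junk values — `f` not analytic at
`z₀`, or `f ≡ 0` near `z₀` — are `0`), then `f` is analytic at `z₀` with `f(z₀) = 0`, and the
order is exactly `1` iff `f'(z₀) ≠ 0`: by the Taylor expansion the order is `n` iff
`f(z₀) = ⋯ = f^{(n-1)}(z₀) = 0 ≠ f^{(n)}(z₀)` (Mathlib
`analyticOrderAt_eq_nat_iff_iteratedDeriv_eq_zero`). [folklore] -/
theorem analyticOrderNatAt_eq_one_iff_deriv_ne_zero {f : ℂ → ℂ} {z₀ : ℂ}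
    (h : 1 ≤ analyticOrderNatAt f z₀) : analyticOrderNatAt f z₀ = 1 ↔ deriv f z₀ ≠ 0 := by
  have h0 : analyticOrderNatAt f z₀ ≠ 0 := Nat.one_le_iff_ne_zero.mp h
  have han : AnalyticAt ℂ f z₀ := by
    by_contra hna
    exact h0 (analyticOrderNatAt_of_not_analyticAt hna)
  have htop : analyticOrderAt f z₀ ≠ ⊤ := by
    intro ht
    exact h0 (by simp [analyticOrderNatAt, ht])
  have hord : analyticOrderAt f z₀ = (analyticOrderNatAt f z₀ : ℕ) :=
    (Nat.cast_analyticOrderNatAt htop).symm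
  obtain ⟨hlow, hne⟩ := (analyticOrderAt_eq_nat_iff_iteratedDeriv_eq_zero han).mp hord
  refine ⟨fun h1 ↦ ?_, fun hd ↦ ?_⟩
  · rw [h1, iteratedDeriv_one] at hne
    exact hne
  · by_contra h1
    have h2 : 1 < analyticOrderNatAt f z₀ := lt_of_le_of_ne h (Ne.symm h1)
    have h3 := hlow 1 h2
    rw [iteratedDeriv_one] at h3
    exact hd h3

omit [NeZero N] in
/-- **`ord_{s=1} L(E/K, s) = 1 ↔ L'(E/K, 1) ≠ 0`, threaded.** The named fact
`analyticRankEK_eq_one_iff_LDerivEK_ne_zero W N K` follows from `one_le_analyticRankEK W N K`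
(`L(E/K, 1) = 0`, i.e. `ord_{s=1} L(E/K, s) ≥ 1`, from the sign `−1` of the functional equation
under the Heegner hypothesis; Gross 1984, §5; Gross–Zagier 1986, I.§7): both `Literature.NumberTheory.EllipticCurves.analyticRankEK`
and `Literature.NumberTheory.EllipticCurves.LDerivEK` are the order, resp. the first derivative, at `s = 1` of the same function
`s ↦ L(E, s) · L(E^{(d_K)}, s)`, so this is `analyticOrderNatAt_eq_one_iff_deriv_ne_zero`. The
forward direction holds unconditionally (`LDerivEK_ne_zero_of_analyticRankEK_eq_one`,
`LeadingTermProofs.lean`); only the converse uses `L(E/K, 1) = 0`. [cite: GrossZagier1986, I.§7] -/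
theorem analyticRankEK_eq_one_iff_LDerivEK_ne_zero_of (h : one_le_analyticRankEK W N K) :
    analyticRankEK_eq_one_iff_LDerivEK_ne_zero W N K := by
  intro _ hK hN hH
  exact analyticOrderNatAt_eq_one_iff_deriv_ne_zero (h hK hN hH)

/-- **bsd.S16, corollary, threaded to the primary facts.** `ord_{s=1} L(E/K, s) = 1 ↔ P_K` is
non-torsion (the named fact `analyticRankEK_eq_one_iff_heegner_nonTorsion W N K`) follows from the
Gross–Zagier theorem (`gross_zagier`) and `L(E/K, 1) = 0` (`one_le_analyticRankEK`) alone
(`analyticRankEK_eq_one_iff_heegner_nonTorsion_of` with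
`analyticRankEK_eq_one_iff_LDerivEK_ne_zero_of`; Gross–Zagier 1986, Thm. I.(6.3) with V.§2;
Gross 1991, (1.1)). [cite: GrossZagier1986, Thm. I.(6.3) with V.§2] -/
theorem analyticRankEK_eq_one_iff_heegner_nonTorsion_of_one_le (hGZ : gross_zagier N W K)
    (h : one_le_analyticRankEK W N K) : analyticRankEK_eq_one_iff_heegner_nonTorsion W N K :=
  analyticRankEK_eq_one_iff_heegner_nonTorsion_of W N K hGZ
    (analyticRankEK_eq_one_iff_LDerivEK_ne_zero_of W N K h)

end Literature.NumberTheory.EllipticCurves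

end
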